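import Literature.MathematicalPhysics.QuantumFieldTheory.Balaban1983to89.B5Block118
import Literature.MathematicalPhysics.QuantumFieldTheory.Balaban1983to89.Beta.KKTFluctuationEnergy

/-!
# `BalabanUV.Beta.GAN24.TorusAvatar` — binder row G-an2-4 / (CONV-C), S6 dictionary (mm channel), leaf P1-L13a part 1 (S6mm-1a):
# THE FIRST JUNCTION OF THE TWO TYPED WORLDS — an2's lattice forms on `ℤ^D` (`Beta/AffineAveraging`: `Site D`, `Form1 D ℝ`) versus
# b05's torus fields (`B5Prop11Plancherel.Tor`, `B5Block118`: `Tor P × Fin D → ℂ`): periodic lattice forms, their TORUS AVATARS,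
# and the block geometry `Tor M × (Fin D → Fin N) ≃ Tor (fine N M)`

NOT IN PRINT; OUR BOOKKEEPING.  HONEST FRAMING (cell contract, verbatim): «discharging `BetaPertH` makes Bałaban's UV stability
UNCONDITIONAL — a real constructive-QFT result; it is NOT the continuum limit and NOT the Clay problem.»  HONEST DEPENDENCY (verbatim):
«continuum YM on T⁴ ⇐ BetaPertH ∧ nine spine estimates (0/9 proved); BetaPertH ⇐ (D1) ∧ (D4) ∧ CAP+tail; G-an2-4 gates asym, D1 and
NE2/3/4.»  This module is [folklore] index bookkeeping (`ZMod` arithmetic, finite sums); it cites nothing, mints no fact (`Periodic` is a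
predicate WITH parameters, a shape, never a hypothesis-free `Prop`), instantiates no wall binder.  NOT summit progress.

WHY (leaf-18's re-cut `HOME/b2b-balaban-gan24-formalise-leaf-18/gen5/S6MM-RECUT.md`, row P1-L13a of the GAN24 SKELETON-P1 table): the S6-mm
identity «`s_m(j)² · wΦ^{(Lc^{j+1})} = cΦ · Δ_{j+1}`» (hypothesis `hdict` of `GAN24/TransverseDictionary`, p200894) is (1.65) = (1.66) for
an2's typed KKT system.  The tree certifies (1.65) = (1.66) ON THE TORUS for b05's typed operators (`B5Hk163Form166`, `B6Cov2156TorusDelK`),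
but no module so far imports both an2's `AffineAveraging` world and b05's `B5Block118` world.  This file is the neutral ground: a
`P`-periodic lattice form `A` has an AVATAR `av A : Tor P × Fin D → ℂ` (evaluate at the canonical lift), and the next file
(`GAN24/TorusAvatarBridge`) proves that b05's `QvOp` ((1.18)) / `CurlOp` ((1.2)) act on avatars as an2's `contourSum` / `curv`, `curvAdj`.

CONTENTS (0 sorry).  §1 `toTor`, `liftT`, `Periodic` and its calculus (`add_mul_zsmul`, `add_periods`, **`Periodic.congr`** — a periodic
function depends only on the class mod `P` —, `apply_liftT_toTor`, `apply_liftT`), `toTor_liftT/add/sub/zsmul/unitVec/periods`.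
§2 periodicity of `curv`, `curvAdj`, translates, and `periodic_contourSum` (the block sums of an `(N·M)`-periodic fine form are `M`-periodic).
§3 the avatars `av`, `av₂` with `av_toTor`, `av_add_unitVec`, `av_sub_unitVec`, `av₂_sub_unitVec` (b05's `e_ν` ↔ an2's `e_ν`).
§4 block geometry: `blk`, `off`, `val_bpt` (`(bpt y j)_ν = N·y_ν + j_ν < N·M_ν`), `blk_bpt`, `off_bpt`, `bpt_blk_off`, **`blockEquiv :
Tor M × (Fin D → Fin N) ≃ Tor (fine N M)`**, `toTor_bpt` (b05's block point `bpt y j` is the class of an2's `N•(lift y) + toSite j`), `toTor_tstep`,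
`toTor_quo_liftT` / `toTor_quo_congr` (an2's block index `quo N` reduces to b05's `blk`).
Unit b2b-balaban-gan24-formalise-leaf-18 (gen 5), 2026-08-19.  NOT the K-slot, NOT `BetaPertH`, NOT continuum, NOT Clay.
-/

open Finset
open scoped BigOperators ComplexConjugate Matrix

namespace Summit.QuantumFields.BalabanUV.Beta.GAN24.TorusAvatar

open Literature.MathematicalPhysics.QuantumFieldTheory
open Literature.MathematicalPhysics.QuantumFieldTheory.Balaban1983to89
open Literature.MathematicalPhysics.QuantumFieldTheory.Balaban1983to89.Beta
open AffineAveraging (Site Form0 Form1 Form2 dz curv curvAdj box toSite contourSum)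
open AffineReproduction (contourSumAdj)
open B5Prop11Plancherel (Tor fine)
open B5Block118 (QvOp QvOp_mulVec lineSum bpt up upHom upHom_intCast iota tstep)
open B5Action121 (CurlOp CurlOp_mulVec Fs_apply sdiff sdiff_conjTranspose_mulVec)

noncomputable section

variable {D : ℕ}

/-! ## §1 Periodic lattice functions, torus points and their lifts -/

/-- Reduction of a lattice point modulo the torus sizes `P`. -/
def toTor (P : Fin D → ℕ) (x : Site D) : Tor P := fun ν => ((x ν : ℤ) : ZMod (P ν))

/-- The canonical lift of a torus point (least nonnegative representatives). -/
def liftT {P : Fin D → ℕ} (z : Tor P) : Site D := fun ν => ((z ν).val : ℤ)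

/-- `P`-PERIODICITY of a lattice function: invariance under the translations `P_ν e_ν`. -/
def Periodic (P : Fin D → ℕ) {R : Type*} (f : Site D → R) : Prop :=
  ∀ (x : Site D) (ν : Fin D), f (x + ((P ν : ℕ) : ℤ) • AffineAveraging.unitVec ν) = f x

namespace Periodic

variable {P : Fin D → ℕ} {R : Type*} {f : Site D → R}

/-- Invariance under integer multiples of the periods in one direction. -/
theorem add_mul_zsmul (hf : Periodic P f) (x : Site D) (ν : Fin D) (k : ℤ) :
    f (x + (((P ν : ℕ) : ℤ) * k) • AffineAveraging.unitVec ν) = f x := by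
  induction k using Int.induction_on generalizing x with
  | zero => simp
  | succ k ih =>
      have h := hf (x + (((P ν : ℕ) : ℤ) * (k : ℤ)) • AffineAveraging.unitVec ν) ν
      rw [add_assoc, ← add_smul, ← mul_add_one] at h
      rw [h, ih]
  | pred k ih =>
      have h := hf (x + (((P ν : ℕ) : ℤ) * (-(k : ℤ) - 1)) • AffineAveraging.unitVec ν) ν
      rw [add_assoc, ← add_smul, show ((P ν : ℕ) : ℤ) * (-(k : ℤ) - 1) + ((P ν : ℕ) : ℤ) = ((P ν : ℕ) : ℤ) * (-(k : ℤ)) by ring]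
        at h
      rw [← h, ih]

/-- Invariance under a lattice vector of periods `ν ↦ P_ν k_ν`. -/
theorem add_periods (hf : Periodic P f) (x : Site D) (k : Fin D → ℤ) :
    f (x + fun ν => ((P ν : ℕ) : ℤ) * k ν) = f x := by
  classical
  have key : ∀ s : Finset (Fin D), ∀ y : Site D,
      f (y + ∑ ν ∈ s, (((P ν : ℕ) : ℤ) * k ν) • AffineAveraging.unitVec ν) = f y := by
    intro s
    induction s using Finset.induction_on with
    | empty => intro y; simp
    | insert ν s hν ih =>
        intro y
        rw [Finset.sum_insert hν, ← add_assoc, add_right_comm, hf.add_mul_zsmul, ih]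
  have e : (fun ν => ((P ν : ℕ) : ℤ) * k ν) = ∑ ν : Fin D, (((P ν : ℕ) : ℤ) * k ν) • AffineAveraging.unitVec ν := by
    funext i
    simp only [Finset.sum_apply, Pi.smul_apply, AffineAveraging.unitVec, Pi.single_apply, smul_eq_mul, mul_ite,
      mul_one, mul_zero, Finset.sum_ite_eq, Finset.mem_univ, if_true]
  rw [e]
  exact key Finset.univ x

/-- **Congruent points have equal values**: a `P`-periodic function depends only on the class mod `P`. -/
theorem congr (hf : Periodic P f) {x y : Site D} (h : toTor P x = toTor P y) : f x = f y := by
  have hd : ∀ ν, ((P ν : ℕ) : ℤ) ∣ y ν - x ν := by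
    intro ν
    have hν := congr_fun h ν
    simp only [toTor] at hν
    exact (ZMod.intCast_eq_intCast_iff_dvd_sub _ _ _).1 hν
  choose k hk using hd
  have e : y = x + fun ν => ((P ν : ℕ) : ℤ) * k ν := by
    funext ν
    simp only [Pi.add_apply]
    have := hk ν
    linarith
  rw [e, hf.add_periods]

/-- The lift of the reduction has the same value. -/
theorem apply_liftT_toTor [∀ ν, NeZero (P ν)] (hf : Periodic P f) (x : Site D) : f (liftT (toTor P x)) = f x := by
  refine hf.congr (funext fun ν => ?_)
  simp only [toTor, liftT, Int.cast_natCast, ZMod.natCast_zmod_val]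

/-- Evaluation at a lift is evaluation at any representative. -/
theorem apply_liftT [∀ ν, NeZero (P ν)] (hf : Periodic P f) {z : Tor P} {y : Site D} (h : toTor P y = z) :
    f (liftT z) = f y := by
  rw [← h, hf.apply_liftT_toTor]

end Periodic

/-- The reduction of a lift is the point. -/
theorem toTor_liftT {P : Fin D → ℕ} [∀ ν, NeZero (P ν)] (z : Tor P) : toTor P (liftT z) = z := by
  funext ν
  simp only [toTor, liftT, Int.cast_natCast, ZMod.natCast_zmod_val]

/-- Reduction is additive. -/
theorem toTor_add (P : Fin D → ℕ) (x y : Site D) : toTor P (x + y) = toTor P x + toTor P y := by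
  funext ν; simp [toTor]

/-- Reduction of a difference. -/
theorem toTor_sub (P : Fin D → ℕ) (x y : Site D) : toTor P (x - y) = toTor P x - toTor P y := by
  funext ν; simp [toTor]

/-- Reduction of an integer multiple. -/
theorem toTor_zsmul (P : Fin D → ℕ) (k : ℤ) (x : Site D) : toTor P (k • x) = k • toTor P x := by
  funext ν; simp [toTor]

/-- Reduction of an2's unit vector is b05's unit vector. -/
theorem toTor_unitVec (P : Fin D → ℕ) (ν : Fin D) :
    toTor P (AffineAveraging.unitVec ν) = B5Prop11Plancherel.unitVec P ν := by
  funext i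
  by_cases h : i = ν
  · subst h; simp [toTor, AffineAveraging.unitVec, B5Prop11Plancherel.unitVec]
  · simp [toTor, AffineAveraging.unitVec, B5Prop11Plancherel.unitVec, h]

/-- Reduction of a period vector vanishes. -/
theorem toTor_periods (P : Fin D → ℕ) (k : Fin D → ℤ) : toTor P (fun ν => ((P ν : ℕ) : ℤ) * k ν) = 0 := by
  funext ν
  simp [toTor]

/-! ## §2 Periodicity is inherited by the lattice operators -/

namespace Periodic

variable {P : Fin D → ℕ}

/-- A translate of a periodic function is periodic. -/
theorem shift {R : Type*} {f : Site D → R} (hf : Periodic P f) (v : Site D) : Periodic P (fun x => f (x + v)) := by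
  intro x ν
  simp only
  rw [add_right_comm, hf]

/-- `curv` of a periodic 1-form is periodic. -/
theorem curv {A : Form1 D ℝ} (hA : ∀ κ, Periodic P (A κ)) (κ l : Fin D) : Periodic P (AffineAveraging.curv A κ l) := by
  intro x ν
  simp only [AffineAveraging.curv]
  rw [add_right_comm x _ (AffineAveraging.unitVec κ), add_right_comm x _ (AffineAveraging.unitVec l), hA, hA, hA, hA]

/-- `curvAdj` of a periodic 2-form is periodic. -/
theorem curvAdj {F : Form2 D ℝ} (hF : ∀ κ l, Periodic P (F κ l)) (μ : Fin D) : Periodic P (AffineAveraging.curvAdj F μ) := by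
  intro x ν
  simp only [AffineAveraging.curvAdj]
  have e : ∀ l, x + ((P ν : ℕ) : ℤ) • AffineAveraging.unitVec ν - AffineAveraging.unitVec l
      = (x - AffineAveraging.unitVec l) + ((P ν : ℕ) : ℤ) • AffineAveraging.unitVec ν := fun l => by abel
  have h1 : ∀ κ l y, F κ l (y + ((P ν : ℕ) : ℤ) • AffineAveraging.unitVec ν) = F κ l y := fun κ l y => hF κ l y ν
  simp only [e, h1]

end Periodic

/-- The block sums of an `(N·M)`-periodic fine 1-form are `M`-periodic in the block index. -/
theorem periodic_contourSum {N : ℕ} {M : Fin D → ℕ} {A : Form1 D ℝ} (hA : ∀ κ, Periodic (fine N M) (A κ)) (κ : Fin D) :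
    Periodic M (contourSum N A κ) := by
  intro y ν
  simp only [contourSum]
  refine Finset.sum_congr rfl fun b _ => Finset.sum_congr rfl fun s _ => ?_
  have e : (N : ℤ) • (y + ((M ν : ℕ) : ℤ) • AffineAveraging.unitVec ν) + toSite b + (s : ℤ) • AffineAveraging.unitVec κ
      = ((N : ℤ) • y + toSite b + (s : ℤ) • AffineAveraging.unitVec κ) + (((fine N M ν : ℕ) : ℤ)) • AffineAveraging.unitVec ν := by
    simp only [fine, Nat.cast_mul, smul_add, smul_smul]
    abel
  rw [e, hA]

/-! ## §3 The torus avatars of periodic lattice forms -/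

/-- THE AVATAR of a lattice 1-form on the torus `Tor P` (b05's vector-field type `Tor P × Fin D → ℂ`): evaluate at the lift. -/
def av {P : Fin D → ℕ} (A : Form1 D ℝ) : Tor P × Fin D → ℂ := fun i => ((A i.2 (liftT i.1) : ℝ) : ℂ)

/-- THE AVATAR of a lattice 2-form (b05's plaquette-field type `Tor P × (Fin D × Fin D) → ℂ`). -/
def av₂ {P : Fin D → ℕ} (F : Form2 D ℝ) : Tor P × (Fin D × Fin D) → ℂ := fun i => ((F i.2.1 i.2.2 (liftT i.1) : ℝ) : ℂ)

/-- Entries of the avatar. -/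
@[simp] theorem av_apply {P : Fin D → ℕ} (A : Form1 D ℝ) (z : Tor P) (κ : Fin D) : av A (z, κ) = ((A κ (liftT z) : ℝ) : ℂ) := rfl

/-- Entries of the 2-form avatar. -/
@[simp] theorem av₂_apply {P : Fin D → ℕ} (F : Form2 D ℝ) (z : Tor P) (κ l : Fin D) :
    av₂ F (z, (κ, l)) = ((F κ l (liftT z) : ℝ) : ℂ) := rfl

/-- The avatar at a reduced point is the lattice value (periodic forms). -/
theorem av_toTor {P : Fin D → ℕ} [∀ ν, NeZero (P ν)] {A : Form1 D ℝ} (hA : ∀ κ, Periodic P (A κ)) (x : Site D) (κ : Fin D) :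
    av A (toTor P x, κ) = ((A κ x : ℝ) : ℂ) := by
  rw [av_apply, (hA κ).apply_liftT_toTor]

/-- Shifting the torus point by b05's `e_ν` shifts the lattice argument by an2's `e_ν`. -/
theorem av_add_unitVec {P : Fin D → ℕ} [∀ ν, NeZero (P ν)] {A : Form1 D ℝ} (hA : ∀ κ, Periodic P (A κ)) (z : Tor P)
    (ν κ : Fin D) :
    av A (z + B5Prop11Plancherel.unitVec P ν, κ) = ((A κ (liftT z + AffineAveraging.unitVec ν) : ℝ) : ℂ) := by
  rw [av_apply, (hA κ).apply_liftT (y := liftT z + AffineAveraging.unitVec ν)]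
  rw [toTor_add, toTor_liftT, toTor_unitVec]

/-- Same for `−e_ν`. -/
theorem av_sub_unitVec {P : Fin D → ℕ} [∀ ν, NeZero (P ν)] {A : Form1 D ℝ} (hA : ∀ κ, Periodic P (A κ)) (z : Tor P)
    (ν κ : Fin D) :
    av A (z - B5Prop11Plancherel.unitVec P ν, κ) = ((A κ (liftT z - AffineAveraging.unitVec ν) : ℝ) : ℂ) := by
  rw [av_apply, (hA κ).apply_liftT (y := liftT z - AffineAveraging.unitVec ν)]
  rw [toTor_sub, toTor_liftT, toTor_unitVec]

/-- Same for 2-forms, `−e_ν`. -/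
theorem av₂_sub_unitVec {P : Fin D → ℕ} [∀ ν, NeZero (P ν)] {F : Form2 D ℝ} (hF : ∀ κ l, Periodic P (F κ l)) (z : Tor P)
    (ν κ l : Fin D) :
    av₂ F (z - B5Prop11Plancherel.unitVec P ν, (κ, l)) = ((F κ l (liftT z - AffineAveraging.unitVec ν) : ℝ) : ℂ) := by
  rw [av₂_apply, (hF κ l).apply_liftT (y := liftT z - AffineAveraging.unitVec ν)]
  rw [toTor_sub, toTor_liftT, toTor_unitVec]

/-! ## §4 Block geometry: `Tor M × (Fin D → Fin N) ≃ Tor (fine N M)` and the lift of a block point -/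

section Blocks

variable (N : ℕ) [NeZero N] (M : Fin D → ℕ) [∀ ν, NeZero (M ν)]

/-- The block index of a fine torus point. -/
def blk (z : Tor (fine N M)) : Tor M := fun ν => (((z ν).val / N : ℕ) : ZMod (M ν))

/-- The offset of a fine torus point inside its block. -/
def off (z : Tor (fine N M)) : Fin D → Fin N := fun ν => ⟨(z ν).val % N, Nat.mod_lt _ (Nat.pos_of_ne_zero (NeZero.ne N))⟩

omit [NeZero N] [∀ ν, NeZero (M ν)] in
/-- `upHom (m mod M_ν) = N·m mod N M_ν` for natural `m`. -/
theorem upHom_natCast (ν : Fin D) (m : ℕ) :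
    upHom N M ν (m : ZMod (M ν)) = (N : ZMod (fine N M ν)) * (m : ZMod (fine N M ν)) := by
  have h := upHom_intCast N M ν (m : ℤ)
  simp only [Int.cast_natCast] at h
  exact h

omit [NeZero N] in
/-- The value of a block point: `(bpt y j)_ν = N·y_ν + j_ν` as a natural number `< N·M_ν`. -/
theorem val_bpt (y : Tor M) (j : Fin D → Fin N) (ν : Fin D) : (bpt N M y j ν).val = N * (y ν).val + (j ν : ℕ) := by
  have hlt : N * (y ν).val + (j ν : ℕ) < fine N M ν := by
    have hy : (y ν).val + 1 ≤ M ν := ZMod.val_lt (y ν)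
    have hj : (j ν : ℕ) < N := (j ν).isLt
    calc N * (y ν).val + (j ν : ℕ) < N * (y ν).val + N := by omega
      _ = N * ((y ν).val + 1) := by ring
      _ ≤ N * M ν := Nat.mul_le_mul_left _ hy
  have hu : upHom N M ν (y ν) = (N : ZMod (fine N M ν)) * (((y ν).val : ℕ) : ZMod (fine N M ν)) := by
    rw [← upHom_natCast N M ν (y ν).val, ZMod.natCast_zmod_val]
  have e : bpt N M y j ν = ((N * (y ν).val + (j ν : ℕ) : ℕ) : ZMod (fine N M ν)) := by
    simp only [bpt, up, iota, Pi.add_apply, hu]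
    push_cast
    ring
  rw [e, ZMod.val_natCast_of_lt hlt]

/-- `blk (bpt y j) = y`. -/
theorem blk_bpt (y : Tor M) (j : Fin D → Fin N) : blk N M (bpt N M y j) = y := by
  funext ν
  simp only [blk, val_bpt]
  rw [Nat.mul_add_div (Nat.pos_of_ne_zero (NeZero.ne N)), Nat.div_eq_of_lt (j ν).isLt, add_zero, ZMod.natCast_zmod_val]

/-- `off (bpt y j) = j`. -/
theorem off_bpt (y : Tor M) (j : Fin D → Fin N) : off N M (bpt N M y j) = j := by
  funext ν
  apply Fin.ext
  simp only [off, val_bpt, Nat.mul_add_mod, Nat.mod_eq_of_lt (j ν).isLt]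

/-- `bpt (blk z) (off z) = z`. -/
theorem bpt_blk_off (z : Tor (fine N M)) : bpt N M (blk N M z) (off N M z) = z := by
  funext ν
  simp only [bpt, up, iota, blk, off, Pi.add_apply]
  rw [upHom_natCast]
  have e : (N : ZMod (fine N M ν)) * ((((z ν).val / N : ℕ)) : ZMod (fine N M ν)) + (((z ν).val % N : ℕ) : ZMod (fine N M ν))
      = (((N * ((z ν).val / N) + (z ν).val % N : ℕ)) : ZMod (fine N M ν)) := by push_cast; ring
  rw [e, Nat.div_add_mod, ZMod.natCast_zmod_val]

/-- **THE BLOCK DECOMPOSITION**: `(y, j) ↦ bpt y j` is a bijection `Tor M × (Fin D → Fin N) ≃ Tor (fine N M)`. -/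
def blockEquiv : Tor M × (Fin D → Fin N) ≃ Tor (fine N M) where
  toFun p := bpt N M p.1 p.2
  invFun z := (blk N M z, off N M z)
  left_inv p := by
    rcases p with ⟨y, j⟩
    simp only [blk_bpt, off_bpt]
  right_inv z := bpt_blk_off N M z

/-- The lift of a block point is `N •` the lift of the block index plus the offset. -/
theorem toTor_bpt (y : Tor M) (j : Fin D → Fin N) :
    toTor (fine N M) ((N : ℤ) • liftT y + toSite (fun i => (j i : ℕ))) = bpt N M y j := by
  funext ν
  have h := val_bpt N M y j ν
  simp only [toTor, Pi.add_apply, Pi.smul_apply, liftT, toSite, smul_eq_mul]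
  rw [← ZMod.natCast_zmod_val (bpt N M y j ν), h]
  push_cast
  ring

/-- The lift of b05's `t e_μ` reduces to an2's `t • e_μ`. -/
theorem toTor_tstep (P : Fin D → ℕ) (μ : Fin D) (t : ℕ) :
    toTor P ((t : ℤ) • AffineAveraging.unitVec μ) = tstep P μ t := by
  funext ν
  by_cases h : ν = μ
  · subst h; simp [toTor, tstep, AffineAveraging.unitVec]
  · simp [toTor, tstep, AffineAveraging.unitVec, h]

end Blocks

end

end Summit.QuantumFields.BalabanUV.Beta.GAN24.TorusAvatar
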